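import Mathlib
import Literature.Analysis.Complex.CauchyPompeiu
import Literature.Analysis.Complex.CauchyTransform
import Literature.Analysis.Complex.CauchyTransformBounds
import Literature.Analysis.Complex.WeylLemmaDbar
import Literature.Topology.PlaneTopology.WindingNumber
import Summits.SmoothPoincare4.SmoothPoincare4.Theorems.SullivanDualTameOrBrodyR4HelperRegularisedCoefficient
import Summits.SmoothPoincare4.SmoothPoincare4.Theorems.SullivanDualTameOrBrodyR4HelperApproxHolomorphic
import Summits.SmoothPoincare4.SmoothPoincare4.Theorems.SullivanDualTameOrBrodyR4HelperWindNeZeroOfZero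

/-!
# The `δ`-regularised similarity principle (stub `helper_zeroFreeOfDbarLe`, line Sketch)

Crux `stmt-SmoothPoincare4-7826` (`TameOrBrodyR4`), line `Sketch`, skeleton v13: the analytic
heart of the planar transversality argument. A smooth `G : ℂ → ℂ` with `∂̄ G = r`,
`‖r‖ ≤ M ‖G‖`, `r = 0` and `‖G - 1‖ < 1` where `‖η‖ ≥ ρ₀`, has no zero.

Classically (Carleman–Bers–Vekua) `|∂̄ G| ≤ M |G|` gives `G = e^s h` with `h` holomorphic, so
the zeros of `G` are those of `h` and are counted by the winding number along a large circle,
which vanishes because `‖G - 1‖ < 1` there. We avoid the discontinuous coefficient `r / G`: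
with the smooth regularised coefficient `a = r · conj G / (|G|² + δ)` (`‖a‖ ≤ M`,
`‖r - a G‖ ≤ M √δ / 2`, `helper_regularisedCoefficient`) and its Cauchy transform `s = T a`
(`∂̄ s = a`, `‖s‖ ≤ S` on a large disc) the function `h = e^{-s} G` has the same zeros as `G`
and `‖∂̄ h‖ = ‖e^{-s} (r - a G)‖ ≤ e^S M √δ / 2`; Cauchy–Pompeiu with a cut-off
(`helper_approxHolomorphic`) gives `H` holomorphic on a disc with `‖h - H‖ ≤ C e^S M √δ / 2`.
On the circle `‖z‖ = ρ₀ + 1` the loop `h ∘ γ` has winding number `0` (`e^{-s ∘ γ}` is the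
exponential of a periodic function, `G ∘ γ` is Rouché-close to `1`) and `‖h‖ ≥ e^{-S} min ‖G‖`;
for `δ` small, Rouché transfers winding number `0` to `(H - H η₀) ∘ γ`, where `η₀` is a putative
zero of `G` (hence of `h`, so `‖H η₀‖` is small too). But `H - H η₀` is holomorphic with a zero
inside the circle and none on it, so its winding number is non-zero
(`helper_windNeZeroOfZero`): contradiction. No limit `δ → 0` is needed.
-/

set_option linter.dupNamespace false

noncomputable section

open scoped ContDiff Topology
open Filter Set Metric
open Literature.Analysis.Complex Literature.Topology.PlaneTopology

namespace Summit.SmoothPoincare4.SmoothPoincare4.Cruxes.TameOrBrodyR4.Sketch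

namespace ZeroFreeOfDbarLe

/-! ### Calculus of `∂̄` for `exp (-s) · G` -/

/-- Chain rule for `∂̄` with the holomorphic outer function `exp`:
`∂̄ (exp ∘ u) = (exp ∘ u) · ∂̄ u` for real-differentiable `u`. -/
theorem dbarAlong_one_cexp {u : ℂ → ℂ} {z : ℂ} (hu : DifferentiableAt ℝ u z) :
    dbarAlong 1 (fun w => Complex.exp (u w)) z = Complex.exp (u z) * dbarAlong 1 u z := by
  rw [dbarAlong_one, dbarAlong_one, hu.hasFDerivAt.cexp.fderiv]
  simp only [FunLike.coe_smul, Pi.smul_apply, smul_eq_mul]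
  ring

/-- `∂̄ (-u) = -∂̄ u`. -/
theorem dbarAlong_one_neg (u : ℂ → ℂ) (z : ℂ) :
    dbarAlong 1 (fun w => -u w) z = -dbarAlong 1 u z := by
  rw [dbarAlong_one, dbarAlong_one, fderiv_fun_neg]
  simp only [_root_.neg_apply, smul_eq_mul]
  ring

/-- The Leibniz–chain rule `∂̄ (e^{-s} G) = e^{-s} (∂̄ G - ∂̄ s · G)`. -/
theorem dbarAlong_one_exp_neg_mul {s G : ℂ → ℂ} {z : ℂ} (hs : DifferentiableAt ℝ s z)
    (hG : DifferentiableAt ℝ G z) :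
    dbarAlong 1 (fun w => Complex.exp (-s w) * G w) z =
      Complex.exp (-s z) * (dbarAlong 1 G z - dbarAlong 1 s z * G z) := by
  rw [dbarAlong_one_mul (a := fun w => Complex.exp (-s w)) hs.fun_neg.cexp hG,
    dbarAlong_one_cexp hs.fun_neg, dbarAlong_one_neg]
  ring

/-! ### Size of `exp (-w)` for `‖w‖ ≤ S` -/

/-- Upper bound `‖exp (-w)‖ ≤ e^S` for `‖w‖ ≤ S`. -/
theorem norm_exp_neg_le {w : ℂ} {S : ℝ} (h : ‖w‖ ≤ S) : ‖Complex.exp (-w)‖ ≤ Real.exp S := by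
  rw [Complex.norm_exp, Real.exp_le_exp, Complex.neg_re]
  have h1 := Complex.abs_re_le_norm w
  have h2 := neg_abs_le w.re
  linarith

/-- Lower bound `e^{-S} ≤ ‖exp (-w)‖` for `‖w‖ ≤ S`. -/
theorem exp_neg_le_norm_exp_neg {w : ℂ} {S : ℝ} (h : ‖w‖ ≤ S) :
    Real.exp (-S) ≤ ‖Complex.exp (-w)‖ := by
  rw [Complex.norm_exp, Real.exp_le_exp, Complex.neg_re]
  have h1 := Complex.re_le_norm w
  linarith

/-! ### The potential `s = T a` -/

/-- **Sup bound for the Cauchy transform** of a density bounded by `M` and vanishing where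
`ρ₀ ≤ ‖z‖`: `‖(T a)(w)‖ ≤ 2 (ρ + ρ₀) M` for `‖w‖ ≤ ρ`. -/
theorem norm_cauchyTransform_le {a : ℂ → ℂ} {ρ₀ ρ M : ℝ} (hρ₀ : 0 ≤ ρ₀) (hρ : 0 ≤ ρ)
    (hM : 0 ≤ M) (ha0 : ∀ z : ℂ, ρ₀ ≤ ‖z‖ → a z = 0) (haM : ∀ z, ‖a z‖ ≤ M) {w : ℂ}
    (hw : ‖w‖ ≤ ρ) : ‖cauchyTransformAlong 1 a w‖ ≤ 2 * (ρ + ρ₀) * M := by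
  refine norm_cauchyTransformAlong_le (by linarith) hM (fun t ht => ?_) (fun t => ?_)
  · rw [smul_eq_mul, mul_one] at ht
    have h1 : ‖w - t‖ < ρ₀ := lt_of_not_ge fun h => ht (ha0 _ h)
    have h2 : ‖t‖ ≤ ‖w‖ + ‖w - t‖ := by
      have := norm_sub_le w (w - t)
      rwa [sub_sub_cancel] at this
    linarith
  · rw [smul_eq_mul, mul_one]
    exact haM _

/-- **The potential.** For a smooth compactly supported density `a` with `‖a‖ ≤ M` vanishing
where `ρ₀ ≤ ‖z‖`, the Cauchy transform `s = T a` is smooth, solves `∂̄ s = a`, and satisfies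
`‖s‖ ≤ 2 (ρ + ρ₀) M` on `‖z‖ ≤ ρ`. -/
theorem exists_potential {a : ℂ → ℂ} {ρ₀ ρ M : ℝ} (hρ₀ : 0 ≤ ρ₀) (hρ : 0 ≤ ρ) (hM : 0 ≤ M)
    (ha : ContDiff ℝ ∞ a) (hac : HasCompactSupport a) (haM : ∀ z, ‖a z‖ ≤ M)
    (ha0 : ∀ z : ℂ, ρ₀ ≤ ‖z‖ → a z = 0) :
    ∃ s : ℂ → ℂ, ContDiff ℝ ∞ s ∧ (∀ z, dbarAlong 1 s z = a z) ∧
      ∀ z : ℂ, ‖z‖ ≤ ρ → ‖s z‖ ≤ 2 * (ρ + ρ₀) * M :=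
  ⟨cauchyTransformAlong 1 a, contDiff_cauchyTransformAlong ha hac one_ne_zero,
    dbarAlong_cauchyTransformAlong (ha.of_le (by exact_mod_cast le_top)) hac one_ne_zero,
    fun _ hz => norm_cauchyTransform_le hρ₀ hρ hM ha0 haM hz⟩

/-! ### Loops on the circle `‖z‖ = R` -/

/-- The loop `t ↦ e^{-s(γ t)} G(γ t)` along the circle `γ = circleLoop 0 R` has winding number
`0` as soon as `‖G - 1‖ < 1` on the circle: the exponential factor is the exponential of a
periodic function, and `G ∘ γ` is Rouché-close to the constant loop `1`. -/
theorem loop_exp_neg_mul {s G : ℂ → ℂ} (hs : Continuous s) (hG : Continuous G) {R : ℝ}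
    (hfar : ∀ t ∈ Icc (0 : ℝ) 1, ‖G (circleLoop 0 R t) - 1‖ < 1) :
    IsNonvanishingLoop (fun t => Complex.exp (-s (circleLoop 0 R t)) * G (circleLoop 0 R t)) ∧
      wind (fun t => Complex.exp (-s (circleLoop 0 R t)) * G (circleLoop 0 R t)) = 0 := by
  have hGl : IsNonvanishingLoop (fun t => G (circleLoop 0 R t)) := by
    refine ⟨(hG.comp (continuous_circleLoop 0 R)).continuousOn, fun t ht h0 => ?_,
      by rw [circleLoop_zero_eq]⟩
    have := hfar t ht
    rw [h0, zero_sub, norm_neg, norm_one] at this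
    exact lt_irrefl _ this
  have hGw : wind (fun t => G (circleLoop 0 R t)) = 0 :=
    (wind_eq_of_norm_sub_lt hGl.continuousOn hGl.eq_endpoints
      (IsNonvanishingLoop.const one_ne_zero) (fun t ht => by
        rw [norm_one]
        exact hfar t ht)).trans (wind_const 1)
  have hEl : IsNonvanishingLoop (fun t => Complex.exp (-s (circleLoop 0 R t))) :=
    ⟨((hs.comp (continuous_circleLoop 0 R)).neg.cexp).continuousOn,
      fun t _ => Complex.exp_ne_zero _, by rw [circleLoop_zero_eq]⟩
  have hEw : wind (fun t => Complex.exp (-s (circleLoop 0 R t))) = 0 :=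
    wind_exp_eq_zero (l := fun t => -s (circleLoop 0 R t))
      ((hs.comp (continuous_circleLoop 0 R)).neg).continuousOn (by rw [circleLoop_zero_eq])
  exact ⟨hEl.mul hGl, by rw [wind_mul hEl hGl, hEw, hGw, add_zero]⟩

/-- **Rouché packaging.** Let `h` give a loop in `ℂ \ {0}` of winding number `0` along the circle
`‖z‖ = R`, with `‖h‖ ≥ b` on the circle and `h η₀ = 0` for some `‖η₀‖ ≤ R`. If `H` is holomorphic
on a larger disc and `‖h - H‖ ≤ e` on `‖z‖ ≤ R` with `2e < b`, then `H - H η₀` does not vanish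
on the circle and has winding number `0` along it. -/
theorem wind_sub_eq_zero {H h : ℂ → ℂ} {ρ' R b e : ℝ} (hR : 0 ≤ R) (hRρ : R < ρ')
    (hH : DifferentiableOn ℂ H (ball 0 ρ'))
    (hloop : IsNonvanishingLoop (fun t => h (circleLoop 0 R t)))
    (hw : wind (fun t => h (circleLoop 0 R t)) = 0)
    (hlow : ∀ z : ℂ, ‖z‖ = R → b ≤ ‖h z‖)
    (happ : ∀ z : ℂ, ‖z‖ ≤ R → ‖h z - H z‖ ≤ e)
    {η₀ : ℂ} (hη₀ : ‖η₀‖ ≤ R) (hh0 : h η₀ = 0) (hbe : 2 * e < b) :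
    (∀ t ∈ Icc (0 : ℝ) 1, H (circleLoop 0 R t) - H η₀ ≠ 0) ∧
      wind (fun t => H (circleLoop 0 R t) - H η₀) = 0 := by
  have hγ : ∀ t, ‖circleLoop 0 R t‖ = R := fun t => by
    simpa using circleLoop_mem_sphere 0 hR t
  have hcont : ContinuousOn (fun t => H (circleLoop 0 R t) - H η₀) (Icc 0 1) := by
    refine ContinuousOn.sub ?_ continuousOn_const
    exact hH.continuousOn.comp (continuous_circleLoop 0 R).continuousOn fun t _ =>
      mem_ball_zero_iff.2 (by rw [hγ]; exact hRρ)
  have h01 : H (circleLoop 0 R 0) - H η₀ = H (circleLoop 0 R 1) - H η₀ := by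
    rw [circleLoop_zero_eq]
  have hH0 : ‖H η₀‖ ≤ e := by simpa [hh0] using happ η₀ hη₀
  have hlt : ∀ t ∈ Icc (0 : ℝ) 1,
      ‖(H (circleLoop 0 R t) - H η₀) - h (circleLoop 0 R t)‖ < ‖h (circleLoop 0 R t)‖ := by
    intro t _
    have h1 := happ (circleLoop 0 R t) (hγ t).le
    have h2 := hlow (circleLoop 0 R t) (hγ t)
    calc ‖H (circleLoop 0 R t) - H η₀ - h (circleLoop 0 R t)‖
        = ‖(H (circleLoop 0 R t) - h (circleLoop 0 R t)) - H η₀‖ := by ring_nf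
      _ ≤ ‖H (circleLoop 0 R t) - h (circleLoop 0 R t)‖ + ‖H η₀‖ := norm_sub_le _ _
      _ ≤ e + e := add_le_add (by rw [norm_sub_rev]; exact h1) hH0
      _ < b := by linarith
      _ ≤ ‖h (circleLoop 0 R t)‖ := h2
  refine ⟨fun t ht h0 => ?_, (wind_eq_of_norm_sub_lt hcont h01 hloop hlt).trans hw⟩
  have := hlt t ht
  rw [h0, zero_sub, norm_neg] at this
  exact lt_irrefl _ this

/-! ### The contradiction -/

/-- **Core of the `δ`-regularised similarity principle.** Under the hypotheses of
`helper_zeroFreeOfDbarLe` and `0 ≤ M`, a zero `η₀` of `G` is contradictory. With the radii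
`ρ₀ + 1 < ρ₀ + 2 < ρ₀ + 3`: let `m > 0` bound `‖G‖` below on the circle `‖z‖ = ρ₀ + 1`, let
`S = 2 (2ρ₀ + 3) M` and `b = e^{-S} m`, and choose `δ = t²` with `C e^S M t < b` (`C` the
constant of `helper_approxHolomorphic`). For the regularised coefficient `a` (smooth, `‖a‖ ≤ M`,
`‖r - a G‖ ≤ M t / 2`) and its Cauchy transform `s` (`∂̄ s = a`, `‖s‖ ≤ S` on `‖z‖ ≤ ρ₀ + 3`)
the function `h = e^{-s} G` has `‖∂̄ h‖ = ‖e^{-s} (r - a G)‖ ≤ e^S M t / 2`, so there is `H`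
holomorphic on `‖z‖ < ρ₀ + 2` with `‖h - H‖ ≤ C e^S M t / 2 < b / 2` on `‖z‖ ≤ ρ₀ + 2`; on the
circle `‖h‖ ≥ b` and `wind (h ∘ γ) = 0`, so by Rouché `H - H η₀` is zero-free on the circle with
winding number `0`, while it vanishes at `η₀` inside: impossible by the argument principle. -/
theorem false_of_zero {G r : ℂ → ℂ} {M ρ₀ : ℝ} (hM : 0 ≤ M) (hG : ContDiff ℝ ∞ G)
    (hr : ContDiff ℝ ∞ r) (hdbar : ∀ η : ℂ, dbarAlong 1 G η = r η)
    (hbound : ∀ η : ℂ, ‖r η‖ ≤ M * ‖G η‖) (hsupp : ∀ η : ℂ, ρ₀ ≤ ‖η‖ → r η = 0)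
    (hfar : ∀ η : ℂ, ρ₀ ≤ ‖η‖ → ‖G η - 1‖ < 1) {η₀ : ℂ} (hz : G η₀ = 0) : False := by
  -- `G ≠ 0` where `ρ₀ ≤ ‖η‖`; the zero lies inside, so `0 < ρ₀`
  have hGne : ∀ η : ℂ, ρ₀ ≤ ‖η‖ → G η ≠ 0 := fun η hη h0 => by
    have := hfar η hη
    rw [h0, zero_sub, norm_neg, norm_one] at this
    exact lt_irrefl _ this
  have hη₀ : ‖η₀‖ < ρ₀ := lt_of_not_ge fun h => hGne η₀ h hz
  have hρ₀ : 0 < ρ₀ := (norm_nonneg η₀).trans_lt hη₀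
  -- the constant of approximate holomorphy for the radii `ρ₀ + 2 < ρ₀ + 3`
  obtain ⟨C, hC0, hC⟩ :=
    helper_approxHolomorphic (ρ₀ + 2) (ρ₀ + 3) (by linarith) (by linarith)
  -- a positive lower bound `m` for `‖G‖` on the circle `‖z‖ = ρ₀ + 1`
  obtain ⟨m, hm0, hm⟩ : ∃ m : ℝ, 0 < m ∧ ∀ z : ℂ, ‖z‖ = ρ₀ + 1 → m ≤ ‖G z‖ := by
    obtain ⟨z₀, hz₀, hmin⟩ := (isCompact_sphere (0 : ℂ) (ρ₀ + 1)).exists_isMinOn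
      ⟨((ρ₀ + 1 : ℝ) : ℂ), mem_sphere_zero_iff_norm.2 (Complex.norm_of_nonneg (by linarith))⟩
      hG.continuous.norm.continuousOn
    have hz₀' : ‖z₀‖ = ρ₀ + 1 := mem_sphere_zero_iff_norm.1 hz₀
    exact ⟨‖G z₀‖, norm_pos_iff.2 (hGne z₀ (by linarith)), fun z hz =>
      hmin (mem_sphere_zero_iff_norm.2 hz)⟩
  -- sizes: `S` bounds the potential, `b = e^{-S} m` bounds `‖h‖` below on the circle
  set S : ℝ := 2 * ((ρ₀ + 3) + ρ₀) * M with hS_def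
  set A : ℝ := C * Real.exp S * M with hA_def
  have hA0 : 0 ≤ A := by positivity
  set b : ℝ := Real.exp (-S) * m with hb_def
  have hb0 : 0 < b := by positivity
  -- the regularisation parameter `δ = t²`, chosen with `A t < b`
  set t : ℝ := b / (A + 1) with ht_def
  have ht0 : 0 < t := by positivity
  have hAt : A * t < b := by
    rw [ht_def, mul_div_assoc', div_lt_iff₀ (by positivity)]
    nlinarith
  -- the regularised coefficient
  obtain ⟨ha, hac, haM, har⟩ :=
    helper_regularisedCoefficient G r M ρ₀ (t ^ 2) hM (by positivity) hG hr hbound hsupp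
  set a : ℂ → ℂ := fun η => r η * (starRingEnd ℂ) (G η) / (((‖G η‖ ^ 2 + t ^ 2 : ℝ)) : ℂ)
    with ha_def
  have ha0 : ∀ η : ℂ, ρ₀ ≤ ‖η‖ → a η = 0 := fun η hη => by simp [ha_def, hsupp η hη]
  have har' : ∀ η, ‖r η - a η * G η‖ ≤ M * t / 2 := fun η => by
    have := har η
    rwa [Real.sqrt_sq ht0.le] at this
  -- the potential
  obtain ⟨s, hs, hds, hsS⟩ :=
    exists_potential (ρ := ρ₀ + 3) hρ₀.le (by linarith) hM ha hac haM ha0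
  have hsd : Differentiable ℝ s := hs.differentiable (by simp)
  have hGd : Differentiable ℝ G := hG.differentiable (by simp)
  -- the modified function `h = e^{-s} G`: small `∂̄`, hence close to a holomorphic `H`
  set h : ℂ → ℂ := fun z => Complex.exp (-s z) * G z with hh_def
  have hh : ContDiff ℝ ∞ h := hs.neg.cexp.mul hG
  have hdh : ∀ z : ℂ, ‖z‖ ≤ ρ₀ + 3 → ‖dbarAlong 1 h z‖ ≤ Real.exp S * (M * t / 2) := by
    intro z hz
    rw [hh_def, dbarAlong_one_exp_neg_mul (hsd z) (hGd z), hdbar z, hds z, norm_mul]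
    exact mul_le_mul (norm_exp_neg_le (hsS z hz)) (har' z) (norm_nonneg _) (Real.exp_pos S).le
  obtain ⟨H, hH, hHh⟩ := hC h (Real.exp S * (M * t / 2)) hh (by positivity) hdh
  -- on the circle: `h` gives a loop of winding number `0` with `‖h‖ ≥ b`
  obtain ⟨hloop, hw⟩ := loop_exp_neg_mul (R := ρ₀ + 1) hs.continuous hG.continuous
    (fun t _ => hfar _ (by
      rw [mem_sphere_zero_iff_norm.1 (circleLoop_mem_sphere 0 (by linarith) t)]
      linarith))
  have hlow : ∀ z : ℂ, ‖z‖ = ρ₀ + 1 → b ≤ ‖h z‖ := fun z hz' => by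
    rw [hh_def, norm_mul]
    exact mul_le_mul (exp_neg_le_norm_exp_neg (hsS z (by linarith))) (hm z hz') hm0.le
      (norm_nonneg _)
  -- Rouché: `H - H η₀` is zero-free on the circle, with winding number `0`
  obtain ⟨hne, hw0⟩ := wind_sub_eq_zero (h := h) (e := C * (Real.exp S * (M * t / 2)))
    (by linarith) (by linarith : ρ₀ + 1 < ρ₀ + 2) hH hloop hw hlow
    (fun z hz' => hHh z (by linarith)) (by linarith : ‖η₀‖ ≤ ρ₀ + 1)
    (by simp [hh_def, hz]) (by
      have : 2 * (C * (Real.exp S * (M * t / 2))) = A * t := by rw [hA_def]; ring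
      linarith)
  -- the argument principle: `H - H η₀` vanishes at `η₀` inside the circle
  exact helper_windNeZeroOfZero (fun z => H z - H η₀) (ρ₀ + 2) (ρ₀ + 1) (by linarith)
    (by linarith) (hH.sub_const _) η₀ (by linarith) (sub_self _) hne hw0

end ZeroFreeOfDbarLe

/-- (A) **The `δ`-regularised similarity principle.** A smooth `G : ℂ → ℂ` with `∂̄ G = r`,
`‖r‖ ≤ M ‖G‖`, `r = 0` and `‖G - 1‖ < 1` for `‖η‖ ≥ ρ₀`, has no zero. (`0 ≤ M` is forced by
testing `‖r‖ ≤ M ‖G‖` at the far point `|ρ₀|`, where `G ≠ 0`; then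
`ZeroFreeOfDbarLe.false_of_zero` applies.) -/
theorem helper_zeroFreeOfDbarLe (G r : ℂ → ℂ) (M ρ₀ : ℝ) (hG : ContDiff ℝ ∞ G) (hr : ContDiff ℝ ∞ r)
    (hdbar : ∀ η : ℂ, Literature.Analysis.Complex.dbarAlong 1 G η = r η)
    (hbound : ∀ η : ℂ, ‖r η‖ ≤ M * ‖G η‖)
    (hsupp : ∀ η : ℂ, ρ₀ ≤ ‖η‖ → r η = 0)
    (hfar : ∀ η : ℂ, ρ₀ ≤ ‖η‖ → ‖G η - 1‖ < 1) : ∀ η : ℂ, G η ≠ 0 := by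
  intro η₀ hz
  -- `0 ≤ M`, tested at the far point `|ρ₀|`, where `G ≠ 0`
  have hM : 0 ≤ M := by
    have h1 := hfar ((|ρ₀| : ℝ) : ℂ) (by
      rw [Complex.norm_of_nonneg (abs_nonneg ρ₀)]
      exact le_abs_self ρ₀)
    have hG1 : G ((|ρ₀| : ℝ) : ℂ) ≠ 0 := fun h0 => by
      rw [h0, zero_sub, norm_neg, norm_one] at h1
      exact lt_irrefl _ h1
    have h2 := (norm_nonneg _).trans (hbound ((|ρ₀| : ℝ) : ℂ))
    exact nonneg_of_mul_nonneg_left h2 (norm_pos_iff.2 hG1)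
  exact ZeroFreeOfDbarLe.false_of_zero hM hG hr hdbar hbound hsupp hfar hz

end Summit.SmoothPoincare4.SmoothPoincare4.Cruxes.TameOrBrodyR4.Sketch

end
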